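import Literature.AlgebraicGeometry.Resolution.WeightedCentreBottomSlotForm
import Literature.AlgebraicGeometry.Resolution.WeightedCentreBottomExact
import HarnessLib

/-!
# Weighted centres — THEOREM A⁺: `X′` is a graded `k[τ]`-substitution with `τ = σ^r` FREE

Instrument for engine 1's `W(f)` TOY MODEL (cell `pub-rosobs`, LF-MODEL-eng1-g45 §6.2 THEOREM A⁺, case `2 ≤ r ≤ p − 1`: "Hence `X′ = Φ∘E` is a graded `k[τ]`-algebra
substitution (wt `τ = r`; `k[τ] → k[σ]` injective, so `τ` may be treated as FREE in the identity `g(X′ε) = g`, which involves `σ` only through `τ`)"), NOT a resolution theorem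
and NOT about the invariant of [AbramovichTemkinWlodarczyk2024].

* `flow_C_one_mul_X_pow_C` — `Φ_𝔇(σ^r)` on `k[ε]` is `expand_r ∘ exp_{<p}(T𝔇)` (`T ↦ σ^r`);
* `aeval_eq_C_of_expand` — if a `k[σ]`-automorphism `x` factors on `k[ε]` as `x ∘ C = expand_r ∘ ψ` for a substitution `ψ : ε_i ↦ P_i(T)`, `r ≥ 1`, then every `g` fixed by `x`
  is fixed by `ψ`: `ψ(g) = g` in `k[ε][T]` (`Polynomial.expand_injective`) — "`τ` may be treated as free";
* `exists_expand_slots` — in the setting of `X_pow_dvd_sub_flow` with `r ∣ p + 1` (e.g. `r = 2`, `p` odd): `x(ε_i) = expand_r (exp_{<p}(T𝔇)(ε_i) + a_i T^{(p+1)/r})` on the slots of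
  weight `≤ p + 1` and `x(ε_i) = ε_i = expand_r(ε_i)` on the heavier ones — the data `P_i(T)` of the `k[T]`-substitution `X′`;
* `apply_C_eq_expand_of_three_le` / `sigmaExp_eq_C_of_three_le` — for `3 ≤ r ≤ p − 1` with the EXACT eigen-relation (`E = id`, `WeightedCentreBottomExact`):
  `x(a) = expand_r (exp_{<p}(T𝔇) a)` for every `a ∈ k[ε]`, so the `k[T]`-substitution is `exp_{<p}(T𝔇)` itself and it fixes every `g` fixed by `x`.

What remains for THEOREM A⁺ (not typed here): the class-linear basis change on `L₁` making `c = e₁` and the appeal to L7 (`KillCoordinates.not_classPinned_symm_apply`).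

References: [Lang2002, Ch. IV §1]; [Matsumura1987, §27]; [AbramovichTemkinWlodarczyk2024, §5.1 (p. 1575), Thm. 5.3.1 (2)–(3) (p. 1578)].
-/

namespace Literature.AlgebraicGeometry.Resolution.WeightedBlowup.BottomClimb

open Polynomial OrderFiltration LevelProjection EigenLiftLevels EigenLift TruncatedFlow ZKernel

variable {k : Type*} [CommRing k] {ι : Type*}

variable {w : ι → ℚ} {p : ℕ} [Fact p.Prime] [CharP k p] {u : ℕ → k}

omit [Fact p.Prime] [CharP k p] in
/-- `Φ_𝔇(σ^r)(a) = expand_r (Σ_{b<p} u_b T^b 𝔇^b a)` for `a ∈ k[ε]` (plumbing: `TruncatedFlow.flowC_apply` and `ZKernel.aeval_X_pow_eq_expand`). [cite: Matsumura1987, §27 (pp. 207–209)] -/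
theorem flow_C_one_mul_X_pow_C (D : Derivation k (MvPolynomial ι k) (MvPolynomial ι k)) (r : ℕ) (a : MvPolynomial ι k) :
    flow D p u (C 1 * X ^ r) (C a) = Polynomial.expand (MvPolynomial ι k) r (sigmaExp D p u a) := by
  rw [flow_C, flowC_apply, Polynomial.map_mul, Polynomial.map_pow, Polynomial.map_X, Polynomial.map_C, map_one, map_one, one_mul,
    aeval_X_pow_eq_expand]

omit [Fact p.Prime] [CharP k p] in
/-- **"`τ` MAY BE TREATED AS FREE"** (LF-MODEL-eng1-g45 §6.2): if the `k[σ]`-automorphism `x` fixes the scalars and factors on `k[ε]` as `x(ε_i) = expand_r(P_i)` (`r ≥ 1`), then the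
`k`-algebra substitution `ψ : ε_i ↦ P_i(T)` into `k[ε][T]` satisfies `x ∘ C = expand_r ∘ ψ`, and every `g ∈ k[ε]` with `x(g) = g` has `ψ(g) = g` — `expand_r : k[ε][T] → k[ε][σ]`, `T ↦ σ^r`,
is injective (`Polynomial.expand_injective`; bookkeeping). [cite: Lang2002, Ch. IV §1] -/
theorem aeval_eq_C_of_expand {x : (MvPolynomial ι k)[X] ≃+* (MvPolynomial ι k)[X]} (hxc : ∀ c : k, x (C (MvPolynomial.C c)) = C (MvPolynomial.C c))
    {r : ℕ} (hr : 0 < r) {P : ι → (MvPolynomial ι k)[X]}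
    (hP : ∀ i, x (C (MvPolynomial.X i)) = Polynomial.expand (MvPolynomial ι k) r (P i)) {g : MvPolynomial ι k} (hg : x (C g) = C g) :
    MvPolynomial.aeval P g = C g := by
  have hcomp : (x : (MvPolynomial ι k)[X] →+* (MvPolynomial ι k)[X]).comp C =
      ((Polynomial.expand (MvPolynomial ι k) r : (MvPolynomial ι k)[X] →ₐ[MvPolynomial ι k] (MvPolynomial ι k)[X]) :
          (MvPolynomial ι k)[X] →+* (MvPolynomial ι k)[X]).comp
        ((MvPolynomial.aeval P : MvPolynomial ι k →ₐ[k] (MvPolynomial ι k)[X]) : MvPolynomial ι k →+* (MvPolynomial ι k)[X]) :=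
    MvPolynomial.ringHom_ext
      (fun c => by
        rw [RingHom.comp_apply, RingEquiv.coe_toRingHom, hxc c, RingHom.comp_apply, AlgHom.coe_toRingHom, AlgHom.coe_toRingHom,
          MvPolynomial.algHom_C, Polynomial.algebraMap_apply, MvPolynomial.algebraMap_eq, expand_C])
      (fun i => by
        rw [RingHom.comp_apply, RingEquiv.coe_toRingHom, hP i, RingHom.comp_apply, AlgHom.coe_toRingHom, AlgHom.coe_toRingHom,
          MvPolynomial.aeval_X])
  have h := RingHom.congr_fun hcomp g
  rw [RingHom.comp_apply, RingEquiv.coe_toRingHom, hg, RingHom.comp_apply, AlgHom.coe_toRingHom, AlgHom.coe_toRingHom] at h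
  exact Polynomial.expand_injective hr (by rw [expand_C, ← h])

/-- **THEOREM A⁺: THE DATA OF `X′` AS A `k[T]`-SUBSTITUTION, `T := σ^r`** (LF-MODEL-eng1-g45 §6.2, case `2 ≤ r ≤ p − 1` with `r ∣ p + 1` — e.g. `r = 2`, `p` odd: "`σ^{p+1} =
τ^{(p+1)/2}`"): in the setting of `X_pow_dvd_sub_flow` there are `a_i ∈ k[ε]`, weighted-homogeneous of weight `w i − (p + 1)`, with
`x(ε_i) = expand_r (Σ_{b<p} u_b T^b 𝔇^b(ε_i) + a_i T^{(p+1)/r})` on every slot of weight `≤ p + 1` and `x(ε_i) = ε_i` (`= expand_r ε_i`) on the heavier slots (`exists_slot_form`,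
`flow_C_one_mul_X_pow_C`).  With `aeval_eq_C_of_expand` this makes `X′` a `k[T]`-isotropy of `g` with `T` free — the input of L7.  Instrument for engine 1's `W(f)` toy model, NOT a
resolution theorem. [cite: Lang2002, Ch. IV §1; Matsumura1987, §27 (pp. 207–209); AbramovichTemkinWlodarczyk2024, §5.1 (p. 1575), Thm. 5.3.1 (2)–(3) (p. 1578)] -/
theorem exists_expand_slots (hu : ∀ n < p, (Nat.factorial n : k) * u n = 1) (hw : ∀ i, 0 ≤ w i)
    {x : (MvPolynomial ι k)[X] ≃+* (MvPolynomial ι k)[X]} (hxg : x ∈ graded w (1 : ℚ)) (hxb : x ∈ baseFixing)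
    (hxV : ∀ i, (p : ℚ) + 1 < w i → x (C (MvPolynomial.X i)) = C (MvPolynomial.X i)) {r : ℕ} (hr2 : 2 ≤ r) (hrp : r ≤ p - 1)
    (hl : x ∈ level (X : (MvPolynomial ι k)[X]) r) {μ₀ : (ZMod p)ˣ} (hμ₀ : orderOf μ₀ = p - 1) {n₀ : ℕ} (hn₀ : (n₀ : ZMod p) = (μ₀ : ZMod p) ^ r)
    {h : (MvPolynomial ι k)[X] ≃+* (MvPolynomial ι k)[X]} (hhg : h ∈ graded w (1 : ℚ)) (hhb : h ∈ baseFixing)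
    (hhV : ∀ i, (p : ℚ) + 1 < w i → h (C (MvPolynomial.X i)) = C (MvPolynomial.X i)) (hhl : h ∈ level (X : (MvPolynomial ι k)[X]) (p + 1))
    (hsx : scaleConj (castUnit p μ₀) x = x ^ n₀ * h) (hdiv : r ∣ p + 1) :
    ∃ a : ι → MvPolynomial ι k, (∀ i, MvPolynomial.IsWeightedHomogeneous w (a i) (w i - ((p : ℚ) + 1))) ∧
      ∀ i, x (C (MvPolynomial.X i)) = Polynomial.expand (MvPolynomial ι k) r
        (if (p : ℚ) + 1 < w i then C (MvPolynomial.X i)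
          else sigmaExp (projDer r x) p u (MvPolynomial.X i) + C (a i) * X ^ ((p + 1) / r)) := by
  have key : ∀ i, ∃ a : MvPolynomial ι k, MvPolynomial.IsWeightedHomogeneous w a (w i - ((p : ℚ) + 1)) ∧
      ((p : ℚ) + 1 < w i ∨ x (C (MvPolynomial.X i)) = flow (projDer r x) p u (C 1 * X ^ r) (C (MvPolynomial.X i)) + C a * X ^ (p + 1)) :=
    fun i => by
      rcases lt_or_ge ((p : ℚ) + 1) (w i) with hi | hi
      · exact ⟨0, MvPolynomial.isWeightedHomogeneous_zero k w _, Or.inl hi⟩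
      · obtain ⟨a, ha, he⟩ := exists_slot_form hu hw hxg hxb hxV hr2 hrp hl hμ₀ hn₀ hhg hhb hhV hhl hsx hi
        exact ⟨a, ha, Or.inr he⟩
  choose a ha he using key
  refine ⟨a, ha, fun i => ?_⟩
  split_ifs with hi
  · rw [expand_C]
    exact hxV i hi
  · rw [map_add, map_mul, expand_C, map_pow, expand_X, ← pow_mul, Nat.mul_div_cancel' hdiv, ← flow_C_one_mul_X_pow_C]
    exact (he i).resolve_left hi

/-- **`r ≥ 3`, exact relation: `x|_{k[ε]} = expand_r ∘ exp_{<p}(T𝔇)`** (LF-MODEL-eng1-g45 §6.2, `E = id` for `r ≥ 3`; from `eq_flow_of_three_le` and `flow_C_one_mul_X_pow_C`;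
bookkeeping).  Instrument for engine 1's `W(f)` toy model, NOT a resolution theorem. [cite: Matsumura1987, §27 (pp. 207–209); Lang2002, Ch. IV §1] -/
theorem apply_C_eq_expand_of_three_le (hu : ∀ n < p, (Nat.factorial n : k) * u n = 1) (hw : ∀ i, 0 ≤ w i)
    {x : (MvPolynomial ι k)[X] ≃+* (MvPolynomial ι k)[X]} (hxg : x ∈ graded w (1 : ℚ)) (hxb : x ∈ baseFixing)
    (hxV : ∀ i, (p : ℚ) + 1 < w i → x (C (MvPolynomial.X i)) = C (MvPolynomial.X i)) {r : ℕ} (hr3 : 3 ≤ r) (hrp : r ≤ p - 1)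
    (hl : x ∈ level (X : (MvPolynomial ι k)[X]) r) {μ₀ : (ZMod p)ˣ} (hμ₀ : orderOf μ₀ = p - 1) {n₀ : ℕ} (hn₀ : (n₀ : ZMod p) = (μ₀ : ZMod p) ^ r)
    (hsx : scaleConj (castUnit p μ₀) x = x ^ n₀) (a : MvPolynomial ι k) :
    x (C a) = Polynomial.expand (MvPolynomial ι k) r (sigmaExp (projDer r x) p u a) := by
  rw [eq_flow_of_three_le hu hw hxg hxb hxV hr3 hrp hl hμ₀ hn₀ hsx (C a), flow_C_one_mul_X_pow_C]

/-- **`r ≥ 3`, exact relation: `exp_{<p}(T𝔇)` with `T` FREE fixes `g`** whenever `x` does (LF-MODEL-eng1-g45 §6.2 "τ may be treated as free", case `h = id`; from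
`apply_C_eq_expand_of_three_le` and `aeval_eq_C_of_expand`).  Instrument for engine 1's `W(f)` toy model, NOT a resolution theorem. [cite: Matsumura1987, §27 (pp. 207–209); Lang2002, Ch. IV §1] -/
theorem sigmaExp_eq_C_of_three_le (hu : ∀ n < p, (Nat.factorial n : k) * u n = 1) (hw : ∀ i, 0 ≤ w i)
    {x : (MvPolynomial ι k)[X] ≃+* (MvPolynomial ι k)[X]} (hxg : x ∈ graded w (1 : ℚ)) (hxb : x ∈ baseFixing)
    (hxV : ∀ i, (p : ℚ) + 1 < w i → x (C (MvPolynomial.X i)) = C (MvPolynomial.X i)) {r : ℕ} (hr3 : 3 ≤ r) (hrp : r ≤ p - 1)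
    (hl : x ∈ level (X : (MvPolynomial ι k)[X]) r) {μ₀ : (ZMod p)ˣ} (hμ₀ : orderOf μ₀ = p - 1) {n₀ : ℕ} (hn₀ : (n₀ : ZMod p) = (μ₀ : ZMod p) ^ r)
    (hsx : scaleConj (castUnit p μ₀) x = x ^ n₀) {g : MvPolynomial ι k} (hg : x (C g) = C g) :
    sigmaExp (projDer r x) p u g = C g := by
  have haeval : MvPolynomial.aeval (fun i => sigmaExp (projDer r x) p u (MvPolynomial.X i)) = sigmaExp (projDer r x) p u :=
    MvPolynomial.algHom_ext fun i => by rw [MvPolynomial.aeval_X]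
  have h := aeval_eq_C_of_expand (P := fun i => sigmaExp (projDer r x) p u (MvPolynomial.X i)) hxb.2 (by omega : 0 < r)
    (fun i => apply_C_eq_expand_of_three_le hu hw hxg hxb hxV hr3 hrp hl hμ₀ hn₀ hsx (MvPolynomial.X i)) hg
  rwa [haeval] at h

end Literature.AlgebraicGeometry.Resolution.WeightedBlowup.BottomClimb
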